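import Literature.MathematicalPhysics.QuantumFieldTheory.Balaban1983to89.Node00.ContinuousTransportOnDomainOfRecord

/-!
# NODE 00 (YM-PLAN Track A) — THE CANONICAL-VERSION TRANSPORT OF RECORD `TcanOfRecord`: the (0.13)∕(3.1) kernel transform read as ITS OWN BEST VERSION —
# continuous on the MAXIMAL open set on which its a.e.-class has a continuous version, the kernel transform verbatim off it — with NO numerics, NO domain,
# NO window and NO proviso in the definition; every good property an UNCONDITIONAL theorem

Cell `pub-ymgap`, NODE 00, seat `pub-ymgap-node00-def-K0e` g3 (prover; K0′ row P7 `contT`), FILE 6 — the RE-POINT this seat put on the table for director-ym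
LINE №125 (2)'s CLOSABILITY GATE («a `Provisos₁₃` row that cannot be supplied is re-pointed in Record13 BEFORE it files»; bus GATE-INPUT-ROW-P7): row P7 (the
β-version proviso `contT` ∕ `contTOn`) is NOT suppliable in any typed form or keying (located note `P7-LOCATOR-AUDIT.md`, evidence #5 on
stmt-QuantumFields-19902: (F1) Jacobian face of (0.4)'s disintegration, (F2) fibrewise level-set nullity, (F3) positivity — standard analysis, none in print for
the χ of record, none in the tree), so the record should carry NO transport-regularity field and let β read a version that is CANONICAL BY CONSTRUCTION wherever the
a.e.-class allows.  [I] = [Balaban1987RG1], [III] = [Balaban1988Convergent].  Imports FILE 2 (`Node00.ContinuousTransportOnDomainOfRecord`: `contVersionOn` and its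
faces, `TcOnOfRecord`; through it FILE 1 `HasContVersionOn`∕`HasContTransportOn` and def-T's `HasContVersion`∕`contVersion`∕`TcOfRecord`∕`isOpenPosMeasure_piHaar_SUN`).
OFFERED to the type owner (node00-def-T, Record13 pen) and the plan; defines NO record predicate and re-points NOTHING of record.  KNIT-BY-NAME; count-neutral;
NOTHING of Bałaban's asserted; NOT a discharge of `contT`.

THE CONSTRUCTION (§1, generic: `α` a second-countable topological measurable space, `μ` a measure; open-positivity of `μ` where stated).
* `regSet μ f := ⋃₀ {U | IsOpen U ∧ HasContVersionOn μ f U}` — THE MAXIMAL REGULAR OPEN SET of the a.e.-class of `f`: open (`isOpen_regSet`), contains every open set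
  on which `f` has a continuous version (`subset_regSet`), depends only on the a.e.-class (`regSet_congr_ae`), `= univ` iff `f` has an everywhere-continuous
  version (`regSet_eq_univ_iff`, for open-positive `μ`).
* **GLUING** (`hasContVersionOn_iUnion_nat`, `hasContVersionOn_regSet`): for open-positive `μ`, `f` HAS a version continuous on `regSet μ f` — countably many local
  versions (a countable subcover of the defining family exists by second countability, Mathlib `TopologicalSpace.isOpen_sUnion_countable`) agree pairwise on the
  (open) overlaps by determinacy (`Measure.eqOn_open_of_ae_eq`), so the first-index gluing is continuous on the union and a.e. equal to `f` there
  (`ae_restrict_iUnion_iff`).  (FILE 3 `Record12ContTResidue` §1 has the two- and three-set gluings; this is the countable one.)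
* `canonVersion μ f := contVersionOn μ f (regSet μ f)` (FILE 2's on-domain version AT the maximal regular set): ALWAYS a version (`canonVersion_ae_eq`, no
  hypothesis at all), continuous on `regSet` (`continuousOn_canonVersion`), and **POINTWISE DETERMINED wherever determinacy is possible**: on EVERY open `U` on which
  SOME a.e.-representative `g` is continuous, `canonVersion μ f = g` at every point of `U` (`canonVersion_eqOn_of_continuousOn`); two a.e.-equal functions have the
  SAME canonical version on their common `regSet` (`canonVersion_eqOn_congr_ae`); it refines def-T's everywhere version (`canonVersion_eq_contVersion` under
  `HasContVersion`) and FILE 2's on-domain version (`canonVersion_eqOn_contVersionOn` on an open `s` under `HasContVersionOn … s`); off `regSet` it is `f` verbatim.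
* §2 AT THE RECORD: **`TcanOfRecord F N : Transport F N := fun K k ρ => canonVersion (piHaar …) (transportOfRecord F N K k ρ)`** — NO numerics argument (contrast
  `TcOnOfRecord ν`), `regSetOfRecord K k ρ`; faces `TcanOfRecord_ae_eq` · `isRT_TcanOfRecord` (every integrable `ρ`, `k < K`) · `integrable_TcanOfRecord` ·
  `continuousOn_TcanOfRecord` · **`TcanOfRecord_eqOn_of_continuousOn`** (print's `𝐍_k e^{A_{k+1}}`, or any continuous representative on any open set of coarse fields,
  IS `TcanOfRecord` there — with no field certifying it) · `TcanOfRecord_eq_TcOfRecord` (under def-T's `HasContTransportAt`: then `regSet = univ`) ·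
  `TcanOfRecord_eqOn_TcOnOfRecord` (on `domAltOfRecord ν K (k+1)` under FILE 1's on-domain proviso at `ρ`) · `domAlt_subset_regSetOfRecord`.
* §3 the β over it, OFFERED: `betaOfRecord₈can θ := betaOfRecord₈T (TcanOfRecord) θ`, `betaOfRecord₉can`; unfolding `rfl`.  Agreement of the β's built over
  `TcOfRecord`∕`TcOnOfRecord`∕`TcanOfRecord` beyond the input-wise `EqOn` faces of §2 is NOT claimed (same honesty line as def-T's READY-13 (μ)(2): the recursion
  feeds each transport its own previous outputs).

WHAT A RECORD GAINS ∕ LOSES by reading `TcanOfRecord` with NO proviso (for the closability table): gains — zero proof obligation on row P7; dag-ref-D's criterion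
«β must read a POINTWISE-DETERMINED density» holds ON `regSet` BY CONSTRUCTION and `regSet` CONTAINS every open set on which print's function could be a
continuous representative; every ₁₀∕₁₂∕READY-13 face stated under `contT`∕`contTOn` becomes an `EqOn` consequence of §2.  Loses — nothing a consumer reads: in the
tree `.contT`∕`HasContTransportAlong` is consumed only as the hypothesis making β-faces version-free (N26 RIDER №6, `Node00/BetaTransportComparison` §3,
`N24GlueStage10C`, the ₁₁-side N08∕N09∕N10 files, K0c's measurability files, this seat's FILES 1–3), and «version-free» is exactly (iii) above on `regSet`.  HOW
LARGE `regSet` is for the β-layer's densities — everywhere? the small-field domain? — is the located-open analysis question (F1)–(F3): a NOTE for the table, no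
longer a field of any record.

HONEST FRAMING: definitions + kernel-checked bookkeeping (Mathlib: second countability, uniqueness of continuous versions on open sets for open-positive measures,
`ae_restrict_iUnion_iff`, `Integrable.congr`); nothing of Bałaban's asserted; no estimate; P7 NOT discharged in any form (this file REMOVES the need to state it as
a proviso, it does not prove it); adopting `TcanOfRecord` in `Record13` is the type owner's one-token decision, not made here; counts unmoved (typed 28∕28 ·
discharged 5∕28); one finite four-torus programme at fixed `ε = L^{−K}` — NOT continuum ∕ ℝ⁴ ∕ OS ∕ mass gap ∕ Clay.  No `sorry`, no `axiom`, no `instance`,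
no `notation`.

v1.1 (same seat, APPEND-ONLY; §1–§3 byte-identical to p484604): §4 transport of `regSet`∕`canonVersion` under mutually inverse continuous MEASURE-PRESERVING maps
leaving the a.e.-class invariant (`preimage_regSet_eq`, `canonVersion_comp_eqOn`); §5 at the record: the transform of a lift-invariant integrable density is a.e.
gauge invariant (`transportOfRecord_comp_gaugeAct_ae_eq`), `regSetOfRecord` is GAUGE-STABLE (`gaugeAct_mem_regSetOfRecord_iff`) and `TcanOfRecord` is gauge
invariant ON it (`TcanOfRecord_gaugeAct_of_mem_regSet`) — node00-def-T g7's CONSUMER-AUDIT ask for the N09 on-domain engine at `T := TcanOfRecord`.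
-/

noncomputable section

open MeasureTheory Set
open scoped BigOperators

namespace Literature.MathematicalPhysics.QuantumFieldTheory.Balaban1983to89.Node00

open _root_.Topology
open T4Continuum (T4Family)
open FlowStep (HBeta)
open B12ContinuousTransportInvarianceOn (isOpen_domAltOfRecord)

/-! ## §1. The maximal regular open set of an a.e.-class and the canonical version (generic) -/

section Generic

variable {α : Type*} [TopologicalSpace α] [MeasurableSpace α] {μ : Measure α} {f : α → ℝ}

variable (μ f) in
/-- **THE MAXIMAL REGULAR OPEN SET** of (the a.e.-class of) `f`: the union of all open sets on which `f` has a continuous version.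
[cite: Balaban1987RG1, (0.13) p.254 and p.259 (bookkeeping: where the transform CAN be read pointwise)] -/
def regSet : Set α := ⋃₀ {U | IsOpen U ∧ HasContVersionOn μ f U}

/-- `regSet μ f` is open. [cite: Balaban1987RG1, (0.13) p.254 (bookkeeping)] -/
theorem isOpen_regSet : IsOpen (regSet μ f) :=
  isOpen_sUnion fun _ hU => hU.1

/-- Every open set carrying a continuous version of `f` lies in `regSet μ f`. [cite: Balaban1987RG1, (0.13) p.254 (bookkeeping)] -/
theorem subset_regSet {U : Set α} (hU : IsOpen U) (h : HasContVersionOn μ f U) : U ⊆ regSet μ f :=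
  subset_sUnion_of_mem ⟨hU, h⟩

/-- Membership: `x ∈ regSet μ f` iff some open neighbourhood of `x` carries a continuous version of `f`. [cite: Balaban1987RG1, (0.13) p.254 (bookkeeping)] -/
theorem mem_regSet_iff {x : α} : x ∈ regSet μ f ↔ ∃ U : Set α, IsOpen U ∧ x ∈ U ∧ HasContVersionOn μ f U := by
  constructor
  · rintro ⟨U, ⟨hU, h⟩, hx⟩
    exact ⟨U, hU, hx, h⟩
  · rintro ⟨U, hU, hx, h⟩
    exact ⟨U, ⟨hU, h⟩, hx⟩

/-- The maximal regular set depends only on the a.e.-class. [cite: Balaban1987RG1, (0.13) p.254 (bookkeeping)] -/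
theorem regSet_congr_ae {f₁ f₂ : α → ℝ} (h : f₁ =ᵐ[μ] f₂) : regSet μ f₁ = regSet μ f₂ := by
  have key : ∀ {g₁ g₂ : α → ℝ}, g₁ =ᵐ[μ] g₂ → regSet μ g₁ ⊆ regSet μ g₂ := by
    intro g₁ g₂ hg x hx
    obtain ⟨U, hU, hxU, hV⟩ := mem_regSet_iff.1 hx
    exact mem_regSet_iff.2 ⟨U, hU, hxU, (hasContVersionOn_congr_ae (ae_restrict_of_ae hg)).1 hV⟩
  exact Subset.antisymm (key h) (key h.symm)

/-- An everywhere-continuous version makes the maximal regular set everything. [cite: Balaban1987RG1, (0.13) p.254 (bookkeeping)] -/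
theorem regSet_eq_univ_of_hasContVersion (h : HasContVersion μ f) : regSet μ f = univ :=
  eq_univ_of_univ_subset (subset_regSet isOpen_univ (h.on univ))

/-- **COUNTABLE GLUING**: for an open-positive measure, if `f` has a continuous version on each of countably many OPEN sets `U n`, it has one on their union —
the local versions agree on the open overlaps (determinacy, `Measure.eqOn_open_of_ae_eq`), so the first-index gluing is continuous and a.e. equal to `f` on the
union. [cite: Balaban1987RG1, (0.13) p.254 (bookkeeping)] -/
theorem hasContVersionOn_iUnion_nat [OpensMeasurableSpace α] [μ.IsOpenPosMeasure] (U : ℕ → Set α) (hU : ∀ n, IsOpen (U n))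
    (h : ∀ n, HasContVersionOn μ f (U n)) : HasContVersionOn μ f (⋃ n, U n) := by
  classical
  choose g hg hae using h
  -- pairwise agreement on overlaps
  have hagree : ∀ m n, EqOn (g m) (g n) (U m ∩ U n) := by
    intro m n
    have hm : ContinuousOn (g m) (U m ∩ U n) := (hg m).mono inter_subset_left
    have hn : ContinuousOn (g n) (U m ∩ U n) := (hg n).mono inter_subset_right
    have haem : g m =ᵐ[μ.restrict (U m ∩ U n)] f := ae_restrict_of_ae_restrict_of_subset inter_subset_left (hae m)
    have haen : g n =ᵐ[μ.restrict (U m ∩ U n)] f := ae_restrict_of_ae_restrict_of_subset inter_subset_right (hae n)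
    exact Measure.eqOn_open_of_ae_eq (haem.trans haen.symm) ((hU m).inter (hU n)) hm hn
  -- the glued function: first index containing the point
  let G : α → ℝ := fun x => if hx : ∃ n, x ∈ U n then g (Nat.find hx) x else f x
  have hG : ∀ n, EqOn G (g n) (U n) := by
    intro n x hx
    have hex : ∃ m, x ∈ U m := ⟨n, hx⟩
    show (if hx : ∃ n, x ∈ U n then g (Nat.find hx) x else f x) = g n x
    rw [dif_pos hex]
    exact hagree _ _ ⟨Nat.find_spec hex, hx⟩
  refine ⟨G, ?_, ?_⟩
  · -- continuity on the union: locally `G = g n` on the open `U n`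
    intro x hx
    obtain ⟨n, hxn⟩ := mem_iUnion.1 hx
    have hcont : ContinuousAt (g n) x := (hg n).continuousAt ((hU n).mem_nhds hxn)
    have heq : g n =ᶠ[𝓝 x] G := (Filter.eventuallyEq_of_mem ((hU n).mem_nhds hxn) (hG n)).symm
    exact (hcont.congr heq).continuousWithinAt
  · -- a.e. on the union, set by set
    rw [Filter.EventuallyEq, ae_restrict_iUnion_iff]
    intro n
    filter_upwards [hae n, self_mem_ae_restrict (hU n).measurableSet] with x hx hxn
    rw [hG n hxn, hx]

/-- **`f` HAS A VERSION CONTINUOUS ON ITS MAXIMAL REGULAR SET** (second-countable `α`, open-positive `μ`): a countable subfamily of the defining open family has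
the same union (`TopologicalSpace.isOpen_sUnion_countable`), and the countable gluing applies. [cite: Balaban1987RG1, (0.13) p.254 (bookkeeping)] -/
theorem hasContVersionOn_regSet [SecondCountableTopology α] [OpensMeasurableSpace α] [μ.IsOpenPosMeasure] : HasContVersionOn μ f (regSet μ f) := by
  obtain ⟨T, hTc, hTS, hTU⟩ :=
    TopologicalSpace.isOpen_sUnion_countable {U : Set α | IsOpen U ∧ HasContVersionOn μ f U} fun U hU => hU.1
  have hreg : regSet μ f = ⋃₀ T := by rw [regSet, hTU]
  rcases T.eq_empty_or_nonempty with hT | hT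
  · rw [hreg, hT, sUnion_empty]
    exact ⟨f, continuousOn_empty f, ae_eq_refl f⟩
  · obtain ⟨U, hUT⟩ := hTc.exists_eq_range hT
    have hU : ∀ n, U n ∈ {U : Set α | IsOpen U ∧ HasContVersionOn μ f U} := fun n => hTS (hUT ▸ mem_range_self n)
    rw [hreg, hUT, sUnion_range]
    exact hasContVersionOn_iUnion_nat U (fun n => (hU n).1) fun n => (hU n).2

/-- For an open-positive measure on a second-countable space: `regSet μ f = univ` iff `f` has an everywhere-continuous version.
[cite: Balaban1987RG1, (0.13) p.254 (bookkeeping)] -/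
theorem regSet_eq_univ_iff [SecondCountableTopology α] [OpensMeasurableSpace α] [μ.IsOpenPosMeasure] : regSet μ f = univ ↔ HasContVersion μ f := by
  refine ⟨fun h => ?_, regSet_eq_univ_of_hasContVersion⟩
  have h' : HasContVersionOn μ f univ := h ▸ hasContVersionOn_regSet
  exact hasContVersionOn_univ_iff.1 h'

variable (μ f) in
/-- **THE CANONICAL VERSION** of `f`: FILE 2's on-domain version AT THE MAXIMAL REGULAR SET — continuous on `regSet μ f` (when `f` has a version there, which
for second-countable `α` and open-positive `μ` is ALWAYS), `f` verbatim off it.  No domain, no numerics enter. [cite: Balaban1987RG1, (0.13) p.254 and p.259 (bookkeeping)] -/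
def canonVersion : α → ℝ := contVersionOn μ f (regSet μ f)

/-- **ALWAYS A VERSION** — no hypothesis whatsoever (FILE 2 `contVersionOn_ae_eq`). [cite: Balaban1987RG1, (0.13) p.254 (bookkeeping)] -/
theorem canonVersion_ae_eq : canonVersion μ f =ᵐ[μ] f := contVersionOn_ae_eq

/-- Off the maximal regular set the canonical version IS `f`. [cite: Balaban1987RG1, (0.13) p.254 (bookkeeping)] -/
theorem canonVersion_eq_of_not_mem {x : α} (hx : x ∉ regSet μ f) : canonVersion μ f x = f x := contVersionOn_eq_of_not_mem hx

/-- Integrability passes to the canonical version. [cite: Balaban1987RG1, (0.13) p.254 (bookkeeping)] -/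
theorem integrable_canonVersion (hf : Integrable f μ) : Integrable (canonVersion μ f) μ := integrable_contVersionOn hf

/-- **CONTINUOUS ON THE MAXIMAL REGULAR SET** (second-countable `α`, open-positive `μ`). [cite: Balaban1987RG1, (0.13) p.254 and p.259 (bookkeeping)] -/
theorem continuousOn_canonVersion [SecondCountableTopology α] [OpensMeasurableSpace α] [μ.IsOpenPosMeasure] : ContinuousOn (canonVersion μ f) (regSet μ f) :=
  continuousOn_contVersionOn hasContVersionOn_regSet

/-- **POINTWISE DETERMINACY WHEREVER IT IS POSSIBLE**: on EVERY open set `U` on which SOME a.e.-representative `g` of `f` is continuous, the canonical version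
EQUALS `g` at every point of `U` (so `U ⊆ regSet` and the value read there is independent of every choice). [cite: Balaban1987RG1, (0.13) p.254 and (0.19) p.255 (bookkeeping)] -/
theorem canonVersion_eqOn_of_continuousOn [SecondCountableTopology α] [OpensMeasurableSpace α] [μ.IsOpenPosMeasure] {U : Set α} (hU : IsOpen U)
    {g : α → ℝ} (hg : ContinuousOn g U) (hae : g =ᵐ[μ.restrict U] f) : EqOn (canonVersion μ f) g U := by
  have hsub : U ⊆ regSet μ f := subset_regSet hU ⟨g, hg, hae⟩
  have hc : ContinuousOn (canonVersion μ f) U := continuousOn_canonVersion.mono hsub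
  have hae' : canonVersion μ f =ᵐ[μ.restrict U] f := ae_restrict_of_ae canonVersion_ae_eq
  exact Measure.eqOn_open_of_ae_eq (hae'.trans hae.symm) hU hc hg

/-- **VERSION-INDEPENDENCE ON THE MAXIMAL REGULAR SET**: a.e.-equal functions have the same maximal regular set and the SAME canonical version at every point of
it. [cite: Balaban1987RG1, (0.13) p.254 (bookkeeping)] -/
theorem canonVersion_eqOn_congr_ae [SecondCountableTopology α] [OpensMeasurableSpace α] [μ.IsOpenPosMeasure] {f₁ f₂ : α → ℝ} (h : f₁ =ᵐ[μ] f₂) :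
    EqOn (canonVersion μ f₁) (canonVersion μ f₂) (regSet μ f₁) := by
  have hreg : regSet μ f₂ = regSet μ f₁ := regSet_congr_ae h.symm
  have hc₂ : ContinuousOn (canonVersion μ f₂) (regSet μ f₁) := hreg ▸ continuousOn_canonVersion
  have hae₂ : canonVersion μ f₂ =ᵐ[μ.restrict (regSet μ f₁)] f₁ := ae_restrict_of_ae (canonVersion_ae_eq.trans h.symm)
  exact canonVersion_eqOn_of_continuousOn isOpen_regSet hc₂ hae₂

/-- It refines def-T's everywhere version: under `HasContVersion μ f` the canonical version IS `contVersion μ f` (both continuous everywhere and a.e. equal to `f`).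
[cite: Balaban1987RG1, (0.13) p.254 (bookkeeping)] -/
theorem canonVersion_eq_contVersion [SecondCountableTopology α] [OpensMeasurableSpace α] [μ.IsOpenPosMeasure] (h : HasContVersion μ f) :
    canonVersion μ f = contVersion μ f := by
  have h1 : EqOn (canonVersion μ f) (contVersion μ f) univ :=
    canonVersion_eqOn_of_continuousOn isOpen_univ (contVersion_spec h).1.continuousOn (by rw [Measure.restrict_univ]; exact contVersion_ae_eq h)
  funext x
  exact h1 (mem_univ x)

/-- It refines FILE 2's on-domain version: on an OPEN `s` carrying a continuous version, the canonical version and `contVersionOn μ f s` agree at every point of `s`.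
[cite: Balaban1987RG1, (0.13) p.254 and p.259 (bookkeeping)] -/
theorem canonVersion_eqOn_contVersionOn [SecondCountableTopology α] [OpensMeasurableSpace α] [μ.IsOpenPosMeasure] {s : Set α} (hs : IsOpen s)
    (h : HasContVersionOn μ f s) : EqOn (canonVersion μ f) (contVersionOn μ f s) s :=
  canonVersion_eqOn_of_continuousOn hs (continuousOn_contVersionOn h) contVersionOn_ae_eq_restrict

end Generic

/-! ## §2. At the record: the canonical-version transport `TcanOfRecord` (no numerics argument) and its unconditional faces -/

section Record

variable (F : T4Family) (N : ℕ) [NeZero N]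

/-- **THE CANONICAL-VERSION TRANSPORT OF RECORD** (def-B's `Transport F N`; NO numerics, NO domain): per torus `K` and step `k`, the kernel transform of record
`transportOfRecord F N K k ρ` ([III] (3.1) read as the one-step disintegration) replaced by its canonical version — continuous on the maximal open set on which
its a.e.-class has a continuous version, verbatim off it. [cite: Balaban1987RG1, (0.13) p.254 and (0.19) p.255; Balaban1988Convergent, (3.1) p.264] -/
def TcanOfRecord : Transport F N :=
  fun K k ρ => canonVersion (piHaar (F.P K) (k + 1) (SU N)) (fun V => transportOfRecord F N K k ρ V)

/-- The maximal regular open set of the transform of record of `ρ` at torus `K`, step `k`. [cite: Balaban1987RG1, (0.13) p.254 (bookkeeping)] -/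
def regSetOfRecord (K k : ℕ) (ρ : Density (F.P K) k (SU N)) : Set (PBond (F.P K) (k + 1) → SU N) :=
  regSet (piHaar (F.P K) (k + 1) (SU N)) (fun V => transportOfRecord F N K k ρ V)

variable {F N}

/-- Unfolding (`rfl`). [cite: Balaban1987RG1, (0.13) p.254 (bookkeeping)] -/
theorem TcanOfRecord_apply (K k : ℕ) (ρ : Density (F.P K) k (SU N)) :
    TcanOfRecord F N K k ρ = canonVersion (piHaar (F.P K) (k + 1) (SU N)) (fun V => transportOfRecord F N K k ρ V) := rfl

/-- **ALWAYS A VERSION OF THE TRANSFORM OF RECORD** (no proviso). [cite: Balaban1987RG1, (0.13) p.254; Balaban1988Convergent, (3.1) p.264] -/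
theorem TcanOfRecord_ae_eq (K k : ℕ) (ρ : Density (F.P K) k (SU N)) :
    (fun V : PBond (F.P K) (k + 1) → SU N => TcanOfRecord F N K k ρ V) =ᵐ[piHaar (F.P K) (k + 1) (SU N)]
      (fun V => transportOfRecord F N K k ρ V) :=
  canonVersion_ae_eq

/-- **ALWAYS A RENORMALISATION TRANSFORMATION** of every integrable `ρ`, `k < K` — NO continuity proviso (FILE 2's argument: the a.e.-equality transfers the
push-forward identity; here via `TcOnOfRecord` at the trivial domain `∅`, whose on-domain version is the transform verbatim). [cite: Balaban1985Averaging, (10) p.19; Balaban1988Convergent, (3.1) p.264] -/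
theorem isRT_TcanOfRecord {K k : ℕ} (hk : k < K) {ρ : Density (F.P K) k (SU N)} (hρ : Integrable ρ (fieldMeasure (F.P K) k (SU N))) :
    IsRT (avOfRecord F N K k).avg ρ (TcanOfRecord F N K k ρ) := by
  intro f hf hfC
  have h0 := isRT_transportCOn (avOfRecord_measurable F N K k) (avOfRecord_haarAC F N K k hk) hρ (∅ : Set (PBond (F.P K) (k + 1) → SU N)) f hf hfC
  rw [← h0]
  refine integral_congr_ae ?_
  have h1 := TcanOfRecord_ae_eq (F := F) (N := N) K k ρ
  have h2 := transportCOn_ae_eq (avOfRecord F N K k).avg ρ (∅ : Set (PBond (F.P K) (k + 1) → SU N))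
  filter_upwards [h1, h2] with V hV1 hV2
  show TcanOfRecord F N K k ρ V * f V = transportCOn (avOfRecord F N K k).avg ρ ∅ V * f V
  rw [hV1, hV2]
  rfl

/-- Its images of integrable densities are integrable, `k < K`. [cite: Balaban1988Convergent, (3.1) p.264 (bookkeeping)] -/
theorem integrable_TcanOfRecord {K k : ℕ} (hk : k < K) {ρ : Density (F.P K) k (SU N)} (hρ : Integrable ρ (fieldMeasure (F.P K) k (SU N))) :
    Integrable (TcanOfRecord F N K k ρ) (fieldMeasure (F.P K) (k + 1) (SU N)) :=
  (integrable_transportCOn (avOfRecord_measurable F N K k) (avOfRecord_haarAC F N K k hk) hρ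
      (∅ : Set (PBond (F.P K) (k + 1) → SU N))).congr
    ((transportCOn_ae_eq (avOfRecord F N K k).avg ρ ∅).trans (TcanOfRecord_ae_eq K k ρ).symm)

/-- **CONTINUOUS ON THE MAXIMAL REGULAR SET** — unconditionally (Pi topology; product Haar on `SU(N)`-valued fields charges open sets, def-T's
`isOpenPosMeasure_piHaar_SUN`). [cite: Balaban1987RG1, (0.13) p.254 and p.259 (bookkeeping)] -/
theorem continuousOn_TcanOfRecord (K k : ℕ) (ρ : Density (F.P K) k (SU N)) :
    ContinuousOn (fun V : PBond (F.P K) (k + 1) → SU N => TcanOfRecord F N K k ρ V) (regSetOfRecord F N K k ρ) :=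
  haveI := isOpenPosMeasure_piHaar_SUN N (F.P K) (k + 1)
  continuousOn_canonVersion

/-- The maximal regular set of record is open. [cite: Balaban1987RG1, (0.13) p.254 (bookkeeping)] -/
theorem isOpen_regSetOfRecord (K k : ℕ) (ρ : Density (F.P K) k (SU N)) : IsOpen (regSetOfRecord F N K k ρ) := isOpen_regSet

/-- **POINTWISE DETERMINACY WHEREVER POSSIBLE, AT THE RECORD**: on EVERY open set `U` of coarse fields on which SOME a.e.-representative `g` of the transform of
record is continuous — e.g. print's `𝐍_k·exp A_{k+1}` on its analyticity domain, IF that identity holds for the record's objects — `TcanOfRecord F N K k ρ = g` at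
EVERY point of `U`, with no field of any record certifying it. [cite: Balaban1987RG1, (0.19) p.255 and p.259] -/
theorem TcanOfRecord_eqOn_of_continuousOn {K k : ℕ} {ρ : Density (F.P K) k (SU N)} {U : Set (PBond (F.P K) (k + 1) → SU N)} (hU : IsOpen U)
    {g : (PBond (F.P K) (k + 1) → SU N) → ℝ} (hg : ContinuousOn g U)
    (hae : g =ᵐ[(piHaar (F.P K) (k + 1) (SU N)).restrict U] fun V => transportOfRecord F N K k ρ V) : EqOn (TcanOfRecord F N K k ρ) g U :=
  haveI := isOpenPosMeasure_piHaar_SUN N (F.P K) (k + 1)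
  canonVersion_eqOn_of_continuousOn hU hg hae

/-- Every open set carrying a continuous version of the transform lies in the maximal regular set of record. [cite: Balaban1987RG1, (0.13) p.254 (bookkeeping)] -/
theorem subset_regSetOfRecord_of_hasContTransportOn {K k : ℕ} {ρ : Density (F.P K) k (SU N)} {U : Set (PBond (F.P K) (k + 1) → SU N)} (hU : IsOpen U)
    (h : HasContTransportOn F N K k ρ U) : U ⊆ regSetOfRecord F N K k ρ :=
  subset_regSet hU h

/-- **REFINES def-T's `TcOfRecord`**: under the everywhere proviso at `ρ` (`HasContTransportAt`), `TcanOfRecord F N K k ρ = TcOfRecord F N K k ρ` as functions (and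
the maximal regular set is everything). [cite: Balaban1987RG1, (0.13) p.254 (bookkeeping)] -/
theorem TcanOfRecord_eq_TcOfRecord {K k : ℕ} {ρ : Density (F.P K) k (SU N)} (h : HasContTransportAt F N K k ρ) :
    TcanOfRecord F N K k ρ = TcOfRecord F N K k ρ := by
  haveI := isOpenPosMeasure_piHaar_SUN N (F.P K) (k + 1)
  funext V
  have h1 := congrFun (canonVersion_eq_contVersion (μ := piHaar (F.P K) (k + 1) (SU N))
    (f := fun V : PBond (F.P K) (k + 1) → SU N => transportOfRecord F N K k ρ V) h) V
  exact h1

/-- … and then `regSetOfRecord = univ`. [cite: Balaban1987RG1, (0.13) p.254 (bookkeeping)] -/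
theorem regSetOfRecord_eq_univ_of_hasContTransportAt {K k : ℕ} {ρ : Density (F.P K) k (SU N)} (h : HasContTransportAt F N K k ρ) :
    regSetOfRecord F N K k ρ = univ :=
  regSet_eq_univ_of_hasContVersion h

/-- **REFINES FILE 2's `TcOnOfRecord ν`**: under the ON-DOMAIN proviso at `ρ` on `domAltOfRecord ν K (k+1)` the two transports agree at every point of the domain.
[cite: Balaban1987RG1, p.259 and (1.2) p.260 (bookkeeping)] -/
theorem TcanOfRecord_eqOn_TcOnOfRecord (ν : Stage7Numerics) {K k : ℕ} {ρ : Density (F.P K) k (SU N)}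
    (h : HasContTransportOn F N K k ρ (domAltOfRecord F N ν K (k + 1))) :
    EqOn (TcanOfRecord F N K k ρ) (TcOnOfRecord F N ν K k ρ) (domAltOfRecord F N ν K (k + 1)) := by
  haveI := isOpenPosMeasure_piHaar_SUN N (F.P K) (k + 1)
  -- the domain is open in the Pi topology (n09-a's lemma is stated over the tree's `GaugeField` topology instance, definitionally the Pi one)
  have hopen : IsOpen (X := PBond (F.P K) (k + 1) → SU N) (domAltOfRecord F N ν K (k + 1)) := isOpen_domAltOfRecord ν K (k + 1)
  intro V hV
  exact canonVersion_eqOn_contVersionOn (μ := piHaar (F.P K) (k + 1) (SU N))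
    (f := fun V : PBond (F.P K) (k + 1) → SU N => transportOfRecord F N K k ρ V) hopen h hV

/-- … and then the small-field domain of the next step lies in the maximal regular set. [cite: Balaban1987RG1, p.259 (bookkeeping)] -/
theorem domAlt_subset_regSetOfRecord (ν : Stage7Numerics) {K k : ℕ} {ρ : Density (F.P K) k (SU N)}
    (h : HasContTransportOn F N K k ρ (domAltOfRecord F N ν K (k + 1))) : domAltOfRecord F N ν K (k + 1) ⊆ regSetOfRecord F N K k ρ :=
  subset_regSet (isOpen_domAltOfRecord ν K (k + 1)) h

/-- Off the maximal regular set `TcanOfRecord` IS the transform of record (version-valued; no face of print reads it there). [cite: Balaban1987RG1, (0.13) p.254 (bookkeeping)] -/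
theorem TcanOfRecord_eq_of_not_mem {K k : ℕ} (ρ : Density (F.P K) k (SU N)) {V : PBond (F.P K) (k + 1) → SU N} (hV : V ∉ regSetOfRecord F N K k ρ) :
    TcanOfRecord F N K k ρ V = transportOfRecord F N K k ρ V :=
  canonVersion_eq_of_not_mem hV

end Record

/-! ## §3. The β of record over the canonical-version transport (OFFERED; bound by no record) -/

section Beta

variable (F : T4Family) (N : ℕ) [NeZero N]

/-- **The β of record read through the canonical-version transport** (Stage-8 parameters): def-T's `betaOfRecord₈T` at `T := TcanOfRecord` — every input
`A_{k+1} = log(𝐍_k⁻¹·(T_k …)(V))` reads values that are POINTWISE DETERMINED on the maximal regular set of that input, with no proviso. [cite: Balaban1987RG1, (1.20)–(1.22) p.264] -/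
def betaOfRecord₈can (θ : Stage8Params F N) : HBeta := betaOfRecord₈T F N (TcanOfRecord F N) θ

/-- The same over Stage-9 parameters. [cite: Balaban1987RG1, (1.20)–(1.22) p.264] -/
def betaOfRecord₉can (θ : Stage9Params F N) : HBeta := betaOfRecord₈can F N θ.toStage8Params

/-- Unfolding (`rfl`). [cite: Balaban1987RG1, (1.20)–(1.22) p.264 (bookkeeping)] -/
theorem betaOfRecord₉can_eq (θ : Stage9Params F N) : betaOfRecord₉can F N θ = betaOfRecord₈T F N (TcanOfRecord F N) θ.toStage8Params := rfl

end Beta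

/-! ## §4. (v1.1) Transport of the maximal regular set and of the canonical version under measure-preserving continuous bijections (generic) —
node00-def-T g7's CONSUMER-AUDIT ask «`regSet` of a gauge-invariant density is gauge-invariant»: Haar-preserving homeomorphisms permute the open sets carrying
continuous versions -/

section Transport

variable {α : Type*} [TopologicalSpace α] [MeasurableSpace α] {μ : Measure α} {f : α → ℝ} {Φ Ψ : α → α}

/-- **A version on an open `U` pulls back** along a continuous, measure-preserving `Φ` under which the a.e.-class of `f` is invariant: `f` has a version continuous on
`Φ ⁻¹' U`. [cite: Balaban1987RG1, (0.13) p.254 and p.263 (bookkeeping)] -/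
theorem HasContVersionOn.preimage_of_measurePreserving [OpensMeasurableSpace α] (hΦc : Continuous Φ) (hΦ : MeasurePreserving Φ μ μ) (hinv : f ∘ Φ =ᵐ[μ] f)
    {U : Set α} (hU : IsOpen U) (h : HasContVersionOn μ f U) : HasContVersionOn μ f (Φ ⁻¹' U) := by
  obtain ⟨g, hg, hae⟩ := h
  refine ⟨g ∘ Φ, hg.comp hΦc.continuousOn fun x hx => hx, ?_⟩
  have h1 : g ∘ Φ =ᵐ[μ.restrict (Φ ⁻¹' U)] f ∘ Φ :=
    ((hΦ.restrict_preimage hU.measurableSet).quasiMeasurePreserving).ae_eq_comp hae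
  exact h1.trans (ae_restrict_of_ae hinv)

omit [TopologicalSpace α] in
/-- The a.e.-invariance transfers to the inverse map (`Ψ` measure-preserving, `Φ ∘ Ψ = id`). [cite: Balaban1987RG1, (0.13) p.254 (bookkeeping)] -/
theorem ae_eq_comp_of_inverse (hΨ : MeasurePreserving Ψ μ μ) (hΦΨ : ∀ x, Φ (Ψ x) = x) (hinv : f ∘ Φ =ᵐ[μ] f) : f ∘ Ψ =ᵐ[μ] f := by
  have h1 : (f ∘ Φ) ∘ Ψ =ᵐ[μ] f ∘ Ψ := hΨ.quasiMeasurePreserving.ae_eq_comp hinv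
  have h2 : (f ∘ Φ) ∘ Ψ = f := funext fun x => by simp only [Function.comp_apply, hΦΨ]
  rw [h2] at h1
  exact h1.symm

/-- `Φ ⁻¹' regSet μ f ⊆ regSet μ f`. [cite: Balaban1987RG1, (0.13) p.254 (bookkeeping)] -/
theorem preimage_regSet_subset [OpensMeasurableSpace α] (hΦc : Continuous Φ) (hΦ : MeasurePreserving Φ μ μ) (hinv : f ∘ Φ =ᵐ[μ] f) :
    Φ ⁻¹' regSet μ f ⊆ regSet μ f := by
  intro x hx
  obtain ⟨U, hU, hxU, hV⟩ := mem_regSet_iff.1 hx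
  exact mem_regSet_iff.2 ⟨Φ ⁻¹' U, hU.preimage hΦc, hxU, hV.preimage_of_measurePreserving hΦc hΦ hinv hU⟩

/-- **THE MAXIMAL REGULAR SET IS INVARIANT**: for mutually inverse continuous measure-preserving `Φ`, `Ψ` with `f ∘ Φ =ᵐ f`: `Φ ⁻¹' regSet μ f = regSet μ f`.
[cite: Balaban1987RG1, (0.13) p.254 and p.263 (bookkeeping)] -/
theorem preimage_regSet_eq [OpensMeasurableSpace α] (hΦc : Continuous Φ) (hΨc : Continuous Ψ) (hΦ : MeasurePreserving Φ μ μ) (hΨ : MeasurePreserving Ψ μ μ)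
    (hΨΦ : ∀ x, Ψ (Φ x) = x) (hΦΨ : ∀ x, Φ (Ψ x) = x) (hinv : f ∘ Φ =ᵐ[μ] f) : Φ ⁻¹' regSet μ f = regSet μ f := by
  refine Subset.antisymm (preimage_regSet_subset hΦc hΦ hinv) fun x hx => ?_
  have hΨinv : f ∘ Ψ =ᵐ[μ] f := ae_eq_comp_of_inverse hΨ hΦΨ hinv
  have h1 : Ψ (Φ x) ∈ regSet μ f := by rw [hΨΦ]; exact hx
  exact preimage_regSet_subset hΨc hΨ hΨinv h1

/-- `Φ` maps the maximal regular set into itself. [cite: Balaban1987RG1, (0.13) p.254 (bookkeeping)] -/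
theorem mapsTo_regSet [OpensMeasurableSpace α] (hΦc : Continuous Φ) (hΨc : Continuous Ψ) (hΦ : MeasurePreserving Φ μ μ) (hΨ : MeasurePreserving Ψ μ μ)
    (hΨΦ : ∀ x, Ψ (Φ x) = x) (hΦΨ : ∀ x, Φ (Ψ x) = x) (hinv : f ∘ Φ =ᵐ[μ] f) : MapsTo Φ (regSet μ f) (regSet μ f) := fun x hx => by
  have h := preimage_regSet_eq hΦc hΨc hΦ hΨ hΨΦ hΦΨ hinv
  show Φ x ∈ regSet μ f
  rw [← mem_preimage, h]
  exact hx

/-- **THE CANONICAL VERSION IS INVARIANT ON THE MAXIMAL REGULAR SET**: `canonVersion μ f (Φ x) = canonVersion μ f x` for every `x ∈ regSet μ f` (second-countable `α`,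
open-positive `μ`; determinacy on the open invariant set). [cite: Balaban1987RG1, (0.13) p.254 and p.263 (bookkeeping)] -/
theorem canonVersion_comp_eqOn [SecondCountableTopology α] [OpensMeasurableSpace α] [μ.IsOpenPosMeasure] (hΦc : Continuous Φ) (hΨc : Continuous Ψ)
    (hΦ : MeasurePreserving Φ μ μ) (hΨ : MeasurePreserving Ψ μ μ) (hΨΦ : ∀ x, Ψ (Φ x) = x) (hΦΨ : ∀ x, Φ (Ψ x) = x) (hinv : f ∘ Φ =ᵐ[μ] f) :
    EqOn (canonVersion μ f ∘ Φ) (canonVersion μ f) (regSet μ f) := by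
  have hmaps := mapsTo_regSet hΦc hΨc hΦ hΨ hΨΦ hΦΨ hinv
  have hc : ContinuousOn (canonVersion μ f ∘ Φ) (regSet μ f) := continuousOn_canonVersion.comp hΦc.continuousOn hmaps
  have hae : canonVersion μ f ∘ Φ =ᵐ[μ.restrict (regSet μ f)] f :=
    ae_restrict_of_ae ((hΦ.quasiMeasurePreserving.ae_eq_comp canonVersion_ae_eq).trans hinv)
  exact (canonVersion_eqOn_of_continuousOn isOpen_regSet hc hae).symm

end Transport

/-! ## §5. (v1.1) At the record: the maximal regular set of the transform of a lift-invariant density is GAUGE-STABLE and the canonical-version transport is gauge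
invariant ON it — the input shape of N09's on-domain engine `B12ContinuousTransportInvarianceOn.invOn_effActionHT_of_stepsOn (T := TcanOfRecord)` -/

section Gauge

variable {F : T4Family} {N : ℕ} [NeZero N]

open B12RTGaugeInvariance254 (LiftInvariant isRT_comp_gaugeAct ae_eq_of_isRT integrable_comp_gaugeAct measurePreserving_gaugeAct invTransf
  gaugeAct_inv_gaugeAct gaugeAct_gaugeAct_inv)
open B12ContinuousTransportInvariance (continuous_gaugeAct)
open T4AveragingDisintegration (integrable_kernelTransport)

/-- **THE TRANSFORM OF A LIFT-INVARIANT DENSITY IS A.E. GAUGE-INVARIANT** ([I] p. 254 in the a.e. currency): for `k < K`, `ρ` integrable and invariant under lifted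
coarse gauge transformations, `(Tρ)(V^v) = (Tρ)(V)` for a.e. `V`, every coarse `v` (`isRT_transportOfRecord` + `isRT_comp_gaugeAct` + a.e. uniqueness of `IsRT` images).
[cite: Balaban1987RG1, (0.13) p.254; Balaban1985Averaging, (11)–(13) p.19] -/
theorem transportOfRecord_comp_gaugeAct_ae_eq {K k : ℕ} (hk : k < K) {ρ : Density (F.P K) k (SU N)} (hρ : Integrable ρ (fieldMeasure (F.P K) k (SU N)))
    (hlift : LiftInvariant ρ) (v : GaugeTransf (F.P K) (k + 1) (SU N)) :
    (fun V => transportOfRecord F N K k ρ (GaugeField.gaugeAct v V)) =ᵐ[fieldMeasure (F.P K) (k + 1) (SU N)] transportOfRecord F N K k ρ := by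
  have hj : k + 1 ≤ (F.P K).m + (F.P K).K := by simp only [T4Continuum.T4Family.P_K]; omega
  have h := isRT_transportOfRecord F N K k hk ρ hρ
  -- integrability of the transform (K0e FILE 3 `integrable_transportOfRecord`, restated locally to keep this module's imports at FILE 2)
  have hi : Integrable (transportOfRecord F N K k ρ) (fieldMeasure (F.P K) (k + 1) (SU N)) :=
    integrable_kernelTransport (fieldMeasure (F.P K) k (SU N)) (fieldMeasure (F.P K) (k + 1) (SU N)) (avOfRecord_measurable F N K k)
      (avOfRecord_haarAC F N K k hk) hρ
  exact ae_eq_of_isRT (isRT_comp_gaugeAct hj (avOfRecord F N K k) h hlift v) h (integrable_comp_gaugeAct hi v) hi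

/-- **THE MAXIMAL REGULAR SET OF RECORD IS GAUGE-STABLE**: for `k < K` and `ρ` integrable and lift-invariant, `V^v ∈ regSetOfRecord K k ρ ↔ V ∈ regSetOfRecord K k ρ`
(coarse gauge transformations are product-Haar-preserving homeomorphisms, `measurePreserving_gaugeAct`, `continuous_gaugeAct`). [cite: Balaban1987RG1, (0.13) p.254 and p.263] -/
theorem gaugeAct_mem_regSetOfRecord_iff {K k : ℕ} (hk : k < K) {ρ : Density (F.P K) k (SU N)} (hρ : Integrable ρ (fieldMeasure (F.P K) k (SU N)))
    (hlift : LiftInvariant ρ) (v : GaugeTransf (F.P K) (k + 1) (SU N)) (V : PBond (F.P K) (k + 1) → SU N) :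
    GaugeField.gaugeAct v V ∈ regSetOfRecord F N K k ρ ↔ V ∈ regSetOfRecord F N K k ρ := by
  -- continuity of the coarse gauge action in the Pi topology (the tree's `GaugeField` topology instance is definitionally the Pi one)
  have hΦc : Continuous (X := PBond (F.P K) (k + 1) → SU N) (Y := PBond (F.P K) (k + 1) → SU N) (GaugeField.gaugeAct v) :=
    continuous_gaugeAct v
  have hΨc : Continuous (X := PBond (F.P K) (k + 1) → SU N) (Y := PBond (F.P K) (k + 1) → SU N) (GaugeField.gaugeAct (invTransf v)) :=
    continuous_gaugeAct (invTransf v)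
  have h := preimage_regSet_eq (μ := piHaar (F.P K) (k + 1) (SU N)) (f := fun V => transportOfRecord F N K k ρ V)
    hΦc hΨc (measurePreserving_gaugeAct v) (measurePreserving_gaugeAct (invTransf v))
    (gaugeAct_inv_gaugeAct v) (gaugeAct_gaugeAct_inv v) (transportOfRecord_comp_gaugeAct_ae_eq hk hρ hlift v)
  have h' := congrArg (fun s : Set (PBond (F.P K) (k + 1) → SU N) => V ∈ s) h
  simp only [mem_preimage, eq_iff_iff] at h'
  exact h'

/-- **THE CANONICAL-VERSION TRANSPORT IS GAUGE INVARIANT ON ITS MAXIMAL REGULAR SET**: for `k < K`, `ρ` integrable and lift-invariant, every coarse `v` and every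
`V ∈ regSetOfRecord K k ρ`: `TcanOfRecord K k ρ (V^v) = TcanOfRecord K k ρ V` — with `isOpen_regSetOfRecord` and `gaugeAct_mem_regSetOfRecord_iff` this is the hypothesis
«continuous and invariant on an OPEN GAUGE-STABLE set» of N09's on-domain engine, at the set `regSetOfRecord`. [cite: Balaban1987RG1, p.254 and p.263] -/
theorem TcanOfRecord_gaugeAct_of_mem_regSet {K k : ℕ} (hk : k < K) {ρ : Density (F.P K) k (SU N)} (hρ : Integrable ρ (fieldMeasure (F.P K) k (SU N)))
    (hlift : LiftInvariant ρ) (v : GaugeTransf (F.P K) (k + 1) (SU N)) {V : PBond (F.P K) (k + 1) → SU N} (hV : V ∈ regSetOfRecord F N K k ρ) :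
    TcanOfRecord F N K k ρ (GaugeField.gaugeAct v V) = TcanOfRecord F N K k ρ V := by
  haveI := isOpenPosMeasure_piHaar_SUN N (F.P K) (k + 1)
  have hΦc : Continuous (X := PBond (F.P K) (k + 1) → SU N) (Y := PBond (F.P K) (k + 1) → SU N) (GaugeField.gaugeAct v) :=
    continuous_gaugeAct v
  have hΨc : Continuous (X := PBond (F.P K) (k + 1) → SU N) (Y := PBond (F.P K) (k + 1) → SU N) (GaugeField.gaugeAct (invTransf v)) :=
    continuous_gaugeAct (invTransf v)
  exact canonVersion_comp_eqOn (μ := piHaar (F.P K) (k + 1) (SU N)) (f := fun V => transportOfRecord F N K k ρ V)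
    hΦc hΨc (measurePreserving_gaugeAct v) (measurePreserving_gaugeAct (invTransf v))
    (gaugeAct_inv_gaugeAct v) (gaugeAct_gaugeAct_inv v) (transportOfRecord_comp_gaugeAct_ae_eq hk hρ hlift v) hV

end Gauge

end Literature.MathematicalPhysics.QuantumFieldTheory.Balaban1983to89.Node00

end
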